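import Summits.PneNP.PneNP.Theses.RamseyThreshold
import Summits.PneNP.PneNP.Theorems.RamseyThresholdNonArrowingCombinatorics
import Summits.PneNP.PneNP.Theorems.DescriptiveNoCanonGivesPneNP
import Literature.Computability.Complexity.KarpCliqueNP
import Literature.Computability.Complexity.CodeFPLists
import Literature.Computability.Complexity.CodeFPListKit
import Literature.Computability.Complexity.CodeFPStrings
import Literature.Computability.Complexity.PRelHierarchy
import Literature.Computability.Complexity.PromiseProofs
import Literature.Computability.Complexity.BranchingFn

/-!
# Route RamseyThreshold — `NonArrowingMemNP` (stmt-PneNP-2055)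

`NONARROW₄ ∈ NP` by the definition `NP = ∃^poly P`: the certificate is the colouring of the ordered vertex pairs
(`n²` bits, bit `u n + v` read for `u < v`), the verifier one typed `CodeFP` program on `(x, y)` — the graph-code test
(`CliqueNP.codeT` on `⟨x, bin 0⟩`, `descriptive_graphCode_iff`) and ONE pass over the `n⁴` quadruples
`((i, j), (k, m)) ∈ ([0,n)²)²`: if `i < j < k < m` are pairwise adjacent then their six colours are not all equal
(`ramseyThreshold_codeFP_quadTest`); soundness / completeness of that test is
`RamseyThresholdNonArrowingCombinatorics`.
-/

set_option linter.dupNamespace false -- `Summit.PneNP.PneNP.…`: summit = sub-problem name (D-0017 single-conjunct layout)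

namespace Summit.PneNP.PneNP.Theorems

open _root_.Computability Polynomial
open Literature.Computability.Complexity Literature.Computability.Complexity.CodeFP
  Literature.Computability.Complexity.Brick

/-- **The typed quadruple test** on `(((A, y), n), ((i, j), (k, m)))` (`A` = adjacency bits, `y` = colour bits, both read at
`u n + v`): `¬(i < j < k < m pairwise adjacent) ∨ ¬(the six colours are all equal)`; polynomial time.
[cite: AroraBarak2009, §1.3] [folklore] -/
theorem ramseyThreshold_codeFP_quadTest :
    CodeFP (pairE (pairE (pairE strE strE) natE) (pairE (pairE natE natE) (pairE natE natE))) bitE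
      fun q : ((List Bool × List Bool) × ℕ) × ((ℕ × ℕ) × (ℕ × ℕ)) =>
        !(decide (q.2.1.1 < q.2.1.2) && (decide (q.2.1.2 < q.2.2.1) && (decide (q.2.2.1 < q.2.2.2) &&
          (q.1.1.1.getD (q.2.1.1 * q.1.2 + q.2.1.2) false && (q.1.1.1.getD (q.2.1.1 * q.1.2 + q.2.2.1) false &&
          (q.1.1.1.getD (q.2.1.1 * q.1.2 + q.2.2.2) false && (q.1.1.1.getD (q.2.1.2 * q.1.2 + q.2.2.1) false &&
          (q.1.1.1.getD (q.2.1.2 * q.1.2 + q.2.2.2) false && q.1.1.1.getD (q.2.2.1 * q.1.2 + q.2.2.2) false)))))))) ||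
        !((q.1.1.2.getD (q.2.1.1 * q.1.2 + q.2.1.2) false == q.1.1.2.getD (q.2.1.1 * q.1.2 + q.2.2.1) false) &&
          ((q.1.1.2.getD (q.2.1.1 * q.1.2 + q.2.1.2) false == q.1.1.2.getD (q.2.1.1 * q.1.2 + q.2.2.2) false) &&
          ((q.1.1.2.getD (q.2.1.1 * q.1.2 + q.2.1.2) false == q.1.1.2.getD (q.2.1.2 * q.1.2 + q.2.2.1) false) &&
          ((q.1.1.2.getD (q.2.1.1 * q.1.2 + q.2.1.2) false == q.1.1.2.getD (q.2.1.2 * q.1.2 + q.2.2.2) false) &&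
          (q.1.1.2.getD (q.2.1.1 * q.1.2 + q.2.1.2) false == q.1.1.2.getD (q.2.2.1 * q.1.2 + q.2.2.2) false))))) := by
  have hA : CodeFP (pairE (pairE (pairE strE strE) natE) (pairE (pairE natE natE) (pairE natE natE))) strE
      fun q : ((List Bool × List Bool) × ℕ) × ((ℕ × ℕ) × (ℕ × ℕ)) => q.1.1.1 := (CodeFP.fst _ _).fst'.fst'
  have hy : CodeFP (pairE (pairE (pairE strE strE) natE) (pairE (pairE natE natE) (pairE natE natE))) strE
      fun q : ((List Bool × List Bool) × ℕ) × ((ℕ × ℕ) × (ℕ × ℕ)) => q.1.1.2 := (CodeFP.fst _ _).fst'.snd'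
  have hn : CodeFP (pairE (pairE (pairE strE strE) natE) (pairE (pairE natE natE) (pairE natE natE))) natE
      fun q : ((List Bool × List Bool) × ℕ) × ((ℕ × ℕ) × (ℕ × ℕ)) => q.1.2 := (CodeFP.fst _ _).snd'
  have hi : CodeFP (pairE (pairE (pairE strE strE) natE) (pairE (pairE natE natE) (pairE natE natE))) natE
      fun q : ((List Bool × List Bool) × ℕ) × ((ℕ × ℕ) × (ℕ × ℕ)) => q.2.1.1 := (CodeFP.snd _ _).fst'.fst'
  have hj : CodeFP (pairE (pairE (pairE strE strE) natE) (pairE (pairE natE natE) (pairE natE natE))) natE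
      fun q : ((List Bool × List Bool) × ℕ) × ((ℕ × ℕ) × (ℕ × ℕ)) => q.2.1.2 := (CodeFP.snd _ _).fst'.snd'
  have hk : CodeFP (pairE (pairE (pairE strE strE) natE) (pairE (pairE natE natE) (pairE natE natE))) natE
      fun q : ((List Bool × List Bool) × ℕ) × ((ℕ × ℕ) × (ℕ × ℕ)) => q.2.2.1 := (CodeFP.snd _ _).snd'.fst'
  have hm : CodeFP (pairE (pairE (pairE strE strE) natE) (pairE (pairE natE natE) (pairE natE natE))) natE
      fun q : ((List Bool × List Bool) × ℕ) × ((ℕ × ℕ) × (ℕ × ℕ)) => q.2.2.2 := (CodeFP.snd _ _).snd'.snd'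
  -- reading a bit `S[u n + v]`
  have rd : ∀ {S : ((List Bool × List Bool) × ℕ) × ((ℕ × ℕ) × (ℕ × ℕ)) → List Bool}
      {U V : ((List Bool × List Bool) × ℕ) × ((ℕ × ℕ) × (ℕ × ℕ)) → ℕ},
      CodeFP (pairE (pairE (pairE strE strE) natE) (pairE (pairE natE natE) (pairE natE natE))) strE S →
      CodeFP (pairE (pairE (pairE strE strE) natE) (pairE (pairE natE natE) (pairE natE natE))) natE U →
      CodeFP (pairE (pairE (pairE strE strE) natE) (pairE (pairE natE natE) (pairE natE natE))) natE V →
      CodeFP (pairE (pairE (pairE strE strE) natE) (pairE (pairE natE natE) (pairE natE natE))) bitE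
        fun q => (S q).getD (U q * q.1.2 + V q) false :=
    fun hS hU hV => (strGetDNat.comp (hS.pair (natAdd.comp ((natMul.comp (hU.pair hn)).pair hV))) :)
  have cq : ∀ {U V U' V' : ((List Bool × List Bool) × ℕ) × ((ℕ × ℕ) × (ℕ × ℕ)) → ℕ},
      CodeFP (pairE (pairE (pairE strE strE) natE) (pairE (pairE natE natE) (pairE natE natE))) natE U →
      CodeFP (pairE (pairE (pairE strE strE) natE) (pairE (pairE natE natE) (pairE natE natE))) natE V →
      CodeFP (pairE (pairE (pairE strE strE) natE) (pairE (pairE natE natE) (pairE natE natE))) natE U' →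
      CodeFP (pairE (pairE (pairE strE strE) natE) (pairE (pairE natE natE) (pairE natE natE))) natE V' →
      CodeFP (pairE (pairE (pairE strE strE) natE) (pairE (pairE natE natE) (pairE natE natE))) bitE
        fun q => q.1.1.2.getD (U q * q.1.2 + V q) false == q.1.1.2.getD (U' q * q.1.2 + V' q) false :=
    fun hU hV hU' hV' => ((CodeFP.beq bitE_injective).comp ((rd hy hU hV).pair (rd hy hU' hV')) :)
  exact ((natLt.comp (hi.pair hj) :).and ((natLt.comp (hj.pair hk) :).and ((natLt.comp (hk.pair hm) :).and
    ((rd hA hi hj).and ((rd hA hi hk).and ((rd hA hi hm).and ((rd hA hj hk).and ((rd hA hj hm).and (rd hA hk hm))))))))).not.or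
    ((cq hi hj hi hk).and ((cq hi hj hi hm).and ((cq hi hj hj hk).and ((cq hi hj hj hm).and (cq hi hj hk hm))))).not

/-- Reading back a colouring of pairs written row-major. [folklore] -/
theorem ramseyThreshold_getD_ofFn_flat {n : ℕ} (c : Sym2 (Fin n) → Bool) (u v : Fin n) :
    (List.ofFn fun t : Fin (n * n) => c s(t.divNat, t.modNat)).getD (u * n + v) false = c s(u, v) := by
  have ht := CliqueNP.flat_lt u v
  rw [List.getD_eq_getElem _ _ (by simpa using ht), List.getElem_ofFn]
  have hu : Fin.divNat ⟨(u : ℕ) * n + v, ht⟩ = u := Fin.ext (show ((u : ℕ) * n + v) / n = u from CliqueNP.flat_div u v)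
  have hv : Fin.modNat ⟨(u : ℕ) * n + v, ht⟩ = v := Fin.ext (show ((u : ℕ) * n + v) % n = v from CliqueNP.flat_mod u v)
  simp only [hu, hv]

/-- A Boolean tautology used to read the test. [folklore] -/
theorem ramseyThreshold_not_or_not_iff (c d : Bool) : (!c || !d) = true ↔ (c = true → ¬ d = true) := by
  cases c <;> cases d <;> simp

/-- **`NonArrowingMemNP` (stmt-PneNP-2055)**: the language of graph codes admitting a 2-colouring of the vertex pairs with
no monochromatic `K₄` of the graph is in `NP` — certificate = the colouring on ordered pairs (`n² ≤ |x|` bits), verifier =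
graph-code test and one pass over the `n⁴` quadruples. [cite: Karp1972, §3 (NP by certificates)]
[cite: AroraBarakCC2009, Def. 2.1] -/
theorem ramseyThreshold_nonArrowingMemNP_proof : Summit.PneNP.PneNP.Theses.RamseyThreshold.NonArrowingMemNP := by
  classical
  -- string-level pieces
  have hfst : CodeFP strE strE fun w : List Bool => fstF w := CodeFP.of_fn fstF fstF_mem_FP fun _ => rfl
  have hsnd : CodeFP strE strE fun w : List Bool => sndF w := CodeFP.of_fn sndF sndF_mem_FP fun _ => rfl
  have hdec : CodeFP strE natE fun w : List Bool => decodeNat w :=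
    CodeFP.of_fn canonF canonF_mem_FP canonF_eq_encodeNat_decodeNat
  have hgc : CodeFP strE bitE fun z : List Bool => decide (CliqueNP.CodeOK (boolPair z (encodeNat 0))) :=
    CodeFP.of_fn (CliqueNP.codeT ∘ fanoutFn id fun _ => encodeNat 0)
      (comp_mem_FP CliqueNP.codeT_mem_FP (fanoutFn_mem_FP (PolyTimeComputable.id _) (const_mem_FP _))) fun z => by
        rw [Function.comp_apply, fanoutFn_apply, CliqueNP.codeT_apply]; rfl
  -- the typed verifier on `(x, y)`
  have hx : CodeFP (pairE strE strE) strE fun t : List Bool × List Bool => t.1 := CodeFP.fst _ _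
  have hyy : CodeFP (pairE strE strE) strE fun t : List Bool × List Bool => t.2 := CodeFP.snd _ _
  have hn0 : CodeFP (pairE strE strE) natE fun t : List Bool × List Bool => decodeNat (fstF t.1) := (hdec.comp (hfst.comp hx) :)
  have hA0 : CodeFP (pairE strE strE) strE fun t : List Bool × List Bool => sndF t.1 := (hsnd.comp hx :)
  have hB : CodeFP (pairE strE strE) unE fun t : List Bool × List Bool => t.1.length := (strLength.comp hx :)
  have hR : CodeFP (pairE strE strE) (rawE natE) fun t : List Bool × List Bool =>
      List.range (min (decodeNat (fstF t.1)) t.1.length) := (rangeOf.comp (hB.pair hn0) :)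
  have hP2 : CodeFP (pairE strE strE) (rawE (pairE natE natE)) fun t : List Bool × List Bool =>
      (List.range (min (decodeNat (fstF t.1)) t.1.length)).product (List.range (min (decodeNat (fstF t.1)) t.1.length)) :=
    ((rawProduct natE natE).comp (hR.pair hR) :)
  have hQ4 := ((rawProduct (pairE natE natE) (pairE natE natE)).comp (hP2.pair hP2) :)
  have hall := ((CodeFP.all ramseyThreshold_codeFP_quadTest).comp (((hA0.pair hyy).pair hn0).pair hQ4) :)
  obtain ⟨g, hg, hgspec⟩ := (hgc.comp hx :).and hall
  -- the verifier language and its value on graph codes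
  set V : Language Bool := g ⁻¹' PRelSigma.HeadIs true with hV
  have hVP : V ∈ Classes.P := preimage_mem_P (PRelSigma.HeadIs_mem_P true) hg
  have hVraw : ∀ x y : List Bool, boolPair x y ∈ V ↔ (g (pairE strE strE (x, y))).head? = some true := fun _ _ => Iff.rfl
  have hlen : ∀ (n : ℕ) (G : SimpleGraph (Fin n)), n * n ≤ (encodingGraph.encode ⟨n, G⟩).length := by
    intro n G
    rw [encodingGraph_encode, CliqueNP.encodingGraphFin_encode_eq, length_boolPair, CliqueNP.length_adjBits]
    dsimp only
    omega
  have hVcode : ∀ x y : List Bool, boolPair x y ∈ V → ∃ (n : ℕ) (G : SimpleGraph (Fin n)), x = encodingGraph.encode ⟨n, G⟩ := by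
    intro x y h
    rw [hVraw, hgspec] at h
    simp only [bitE, List.head?_cons, Option.some.injEq, Bool.and_eq_true, decide_eq_true_eq] at h
    have h1 : CliqueNP.codeT (boolPair x (encodeNat 0)) = [true] := by rw [CliqueNP.codeT_apply, decide_eq_true h.1]
    exact (descriptive_graphCode_iff x).1 h1
  have hVgen : ∀ (n : ℕ) (G : SimpleGraph (Fin n)) (y : List Bool), boolPair (encodingGraph.encode ⟨n, G⟩) y ∈ V ↔
      ∀ i j k m : Fin n, i < j → j < k → k < m → G.Adj i j → G.Adj i k → G.Adj i m → G.Adj j k → G.Adj j m → G.Adj k m →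
        ¬ (y.getD (i * n + j) false = y.getD (i * n + k) false ∧ y.getD (i * n + j) false = y.getD (i * n + m) false ∧
          y.getD (i * n + j) false = y.getD (j * n + k) false ∧ y.getD (i * n + j) false = y.getD (j * n + m) false ∧
            y.getD (i * n + j) false = y.getD (k * n + m) false) := by
    intro n G y
    have hcode : decide (CliqueNP.CodeOK (boolPair (encodingGraph.encode ⟨n, G⟩) (encodeNat 0))) = true := by
      rw [← List.singleton_inj (α := Bool), ← CliqueNP.codeT_apply, descriptive_graphCode_iff]; exact ⟨n, G, rfl⟩
    have hmin : min (decodeNat (fstF (encodingGraph.encode ⟨n, G⟩))) (encodingGraph.encode ⟨n, G⟩).length = n := by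
      have h1 : fstF (encodingGraph.encode ⟨n, G⟩) = encodeNat n := by
        rw [encodingGraph_encode, fstF_boolPair]
      rw [h1, Computability.decode_encodeNat]
      exact min_eq_left ((Nat.le_mul_self n).trans (hlen n G))
    have hAd : sndF (encodingGraph.encode ⟨n, G⟩) = CliqueNP.adjBits n G := by
      rw [encodingGraph_encode, CliqueNP.encodingGraphFin_encode_eq, sndF_boolPair]
    have hnn : decodeNat (fstF (encodingGraph.encode ⟨n, G⟩)) = n := by
      rw [encodingGraph_encode, fstF_boolPair, Computability.decode_encodeNat]
    rw [hVraw, hgspec]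
    simp only [bitE, List.head?_cons, Option.some.injEq, Bool.and_eq_true, hcode, true_and, List.all_eq_true]
    rw [hmin, hAd, hnn]
    constructor
    · intro h i j k m hij hjk hkm aij aik aim ajk ajm akm
      have h' := h ((i, j), (k, m)) (by simp [List.pair_mem_product, i.isLt, j.isLt, k.isLt, m.isLt])
      rw [ramseyThreshold_not_or_not_iff] at h'
      simp only [Bool.and_eq_true, decide_eq_true_eq, CliqueNP.getD_adjBits_flat, beq_iff_eq] at h'
      exact h' ⟨hij, hjk, hkm, aij, aik, aim, ajk, ajm, akm⟩
    · rintro h ⟨⟨i, j⟩, ⟨k, m⟩⟩ hmem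
      simp only [List.pair_mem_product, List.mem_range] at hmem
      obtain ⟨⟨hi, hj⟩, ⟨hk, hm⟩⟩ := hmem
      rw [ramseyThreshold_not_or_not_iff]
      simp only [Bool.and_eq_true, decide_eq_true_eq, beq_iff_eq]
      rintro ⟨hij, hjk, hkm, aij, aik, aim, ajk, ajm, akm⟩
      have e := fun (u v : Fin n) => CliqueNP.getD_adjBits_flat G u v
      have a1 := e ⟨i, hi⟩ ⟨j, hj⟩; have a2 := e ⟨i, hi⟩ ⟨k, hk⟩; have a3 := e ⟨i, hi⟩ ⟨m, hm⟩
      have a4 := e ⟨j, hj⟩ ⟨k, hk⟩; have a5 := e ⟨j, hj⟩ ⟨m, hm⟩; have a6 := e ⟨k, hk⟩ ⟨m, hm⟩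
      dsimp only at a1 a2 a3 a4 a5 a6
      rw [a1, decide_eq_true_eq] at aij; rw [a2, decide_eq_true_eq] at aik; rw [a3, decide_eq_true_eq] at aim
      rw [a4, decide_eq_true_eq] at ajk; rw [a5, decide_eq_true_eq] at ajm; rw [a6, decide_eq_true_eq] at akm
      exact h ⟨i, hi⟩ ⟨j, hj⟩ ⟨k, hk⟩ ⟨m, hm⟩ hij hjk hkm aij aik aim ajk ajm akm
  -- NP by definition
  refine ⟨V, hVP, X, fun x => ?_⟩
  constructor
  · rintro ⟨⟨n, G⟩, ⟨c, hc⟩, rfl⟩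
    refine ⟨List.ofFn fun t : Fin (n * n) => c s(t.divNat, t.modNat), ?_, ?_⟩
    · rw [eval_X, List.length_ofFn]
      exact hlen n G
    · rw [hVgen]
      intro i j k m hij hjk hkm aij aik aim ajk ajm akm
      simp only [ramseyThreshold_getD_ofFn_flat]
      exact ramseyThreshold_quadruples_of_nonArrowing G c hc i j k m hij hjk hkm aij aik aim ajk ajm akm
  · rintro ⟨y, -, hy⟩
    obtain ⟨n, G, rfl⟩ := hVcode x y hy
    have h := (hVgen n G y).1 hy
    refine ⟨⟨n, G⟩, ?_, rfl⟩
    exact ramseyThreshold_nonArrowing_of_quadruples G (fun u v => y.getD (u * n + v) false) h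

end Summit.PneNP.PneNP.Theorems
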